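import Summits.Langlands.Langlands.Theorems.DyadicOddResidueSectorComplementRankTwoData
import Summits.Langlands.Langlands.Theorems.DyadicOddResidueSectorComplementStubAutomorphicTwistData
import Summits.Langlands.Langlands.Theorems.DyadicOddResidueSectorComplementStubEpsTransport
import Summits.Langlands.Langlands.Theorems.DyadicOddResidueSectorComplementStubEpsArtinEq
import Summits.Langlands.Langlands.Statement
import Summits.Langlands.Langlands.Theorems.DyadicOddResidueSectorComplementRigidityTransport
import Literature.NumberTheory.Automorphic.LocalComponentBJGenericProofs
import Literature.NumberTheory.EllipticCurves.EisensteinNewformLevelRaisingInertiaNewvectorProofs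
import HarnessLib

/-!
# Rank-2 generic rigidity of pinned local Langlands data (line `Sketch_18745_r1_k1`, crux
`DyadicOddResidue.SectorComplement`, stmt-Langlands-18745): a Frobenius-semisimple two-dimensional
parameter is determined by its twist data, hence `rec₂[π] = rec'₂[π]` on generic
non-supercuspidal classes

Assembly of the registered stubs of the rank-2 attack on S5
(`stub_recGL_eq_of_isGeneric_of_not_isSupercuspidal`):

* the twist data of the normal forms and the recovery theorem (T2) are in `…RankTwoData`;
* `rec_two_eq_of_isGeneric_of_not_isSupercuspidal` /
  `recGL_two_eq_of_isGeneric_of_not_isSupercuspidal` — S5 in rank 2 for two correspondences with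
  the same normalising data, resp. for two PINNED reciprocity data of a number field, under the
  explicit hypothesis `hB` = the Bump 1997 §4.7 / Jacquet–Langlands 1970 Props. 3.5–3.6 fact
  (a generic non-supercuspidal `π` of `GL₂` has a non-trivial twisted `L`-factor), vendored
  separately as the named fact `Bump1997_gl2_exists_twist_rsLFactor_ne_one`.

* `globalLanglands_two_transport` — COROLLARY: the summit's `∀ 𝓡` is free in rank 2, i.e.
  `(A) ∧ (B)` for `GL₂/K` transports from one pinned reciprocity datum to any other, modulo
  Henniart 1993 (named fact `localLanglands_gl` at every place) and the Bump fact.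

No definitions; std axioms.
-/

noncomputable section

set_option linter.dupNamespace false

open scoped TensorProduct MatrixGroups NumberField
open Module Polynomial MeasureTheory NumberField IsDedekindDomain Summit.Langlands
open Literature.NumberTheory.Automorphic Literature.NumberTheory.GaloisRepresentations
open Literature.NumberTheory.GaloisRepresentations.IsNonarchimedeanLocalField
open Literature.NumberTheory.EllipticCurves.Hida2000Thm326

namespace Summit.Langlands.Langlands.Theorems.ReciprocityRigidity

variable {F : Type} [Field F] [ValuativeRel F] [TopologicalSpace F] [IsNonarchimedeanLocalField F]



/-! ## S5a: rank-2 rigidity on generic non-supercuspidal classes -/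

section Final

variable {hmul : @IsFrobPow.mul F _ _ _ _} {huniq : @IsFrobPow.unique F _ _ _ _}
  {hn : absInertia_normal F} {hex : @exists_isFrobPow F _ _ _ _}
  {hns : @WeilGroup.exists_subgroup_le_inertia_isOpen_of_continuous F _ _ _ _}
  {d : LocalArtinData F} {𝓔 : LocalEpsilonSystem F}
  {rec rec' : ∀ n : ℕ, IrrClass (GL (Fin n) F) → Quotient (frobSemisimpleWDSetoid F n)}

/-- The twisted Euler factor `eulerFactor (rec₂[π] ⊗ (χ ∘ artin))` is the pair Euler factor of
`(π, χ ∘ det)` (isomorphism invariance, stub W2-A, and `rec₁[χ ∘ det] ≅ χ ∘ artin`). [folklore] -/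
theorem twistEulerFactor_eq_pair (h : IsLocalLanglandsGL F hmul huniq hn hex hns d 𝓔 rec)
    (π : SmoothIrrep (GL (Fin 2) F)) (χ : QuasiChar F) :
    (((rec 2 (IrrClass.mk π)).out.1).tprod
        (WeilDeligneRep.ofQuasiCharOn (Fin 1 → ℂ) hns d χ)).eulerFactor hn hex =
      (((rec 2 (IrrClass.mk π)).out.1).tprod
        ((rec 1 (IrrClass.mk (SmoothIrrep.ofQuasiChar χ))).out.1)).eulerFactor hn hex :=
  stub_eulerFactor_eq_of_isEquivalent hn hex
    (isEquivalent_tprod_right _ (out_rec_one_isEquivalent_ofQuasiCharOn h χ).symm)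

/-- **Twist data are correspondence-independent**: for generic `π` of `GL₂(F)` and every
quasi-character `χ`, `eulerFactor (rec₂[π] ⊗ (χ ∘ artin)) = eulerFactor (rec'₂[π] ⊗ (χ ∘ artin))`.
[cite: JacquetPiatetskiShapiroShalika1983, Thm 2.7] [cite: HarrisTaylorAMS2001, Thm. A] -/
theorem twistEulerFactor_eq_of_isLocalLanglandsGL
    (h : IsLocalLanglandsGL F hmul huniq hn hex hns d 𝓔 rec)
    (h' : IsLocalLanglandsGL F hmul huniq hn hex hns d 𝓔 rec')
    (π : SmoothIrrep (GL (Fin 2) F)) {ψ : AddChar F Circle} (hψ : ψ.IsContinuousNontrivial)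
    (hg : IsGeneric π.ρ ψ) (χ : QuasiChar F) :
    (((rec 2 (IrrClass.mk π)).out.1).tprod
        (WeilDeligneRep.ofQuasiCharOn (Fin 1 → ℂ) hns d χ)).eulerFactor hn hex =
      (((rec' 2 (IrrClass.mk π)).out.1).tprod
        (WeilDeligneRep.ofQuasiCharOn (Fin 1 → ℂ) hns d χ)).eulerFactor hn hex := by
  rw [twistEulerFactor_eq_pair h π χ, twistEulerFactor_eq_pair h' π χ]
  exact eulerFactor_pair_eq_of_isLocalLanglandsGL h h' π hψ hg _

/-! The ONE external input of the rank-2 step is the hypothesis `hB` below — Bump 1997, §4.7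
((7.9)–(7.10), Prop. 4.7.1, Prop. 4.7.5) = Jacquet–Langlands 1970, Props. 3.5–3.6: a generic
NON-supercuspidal irreducible `π` of `GL₂` over a non-archimedean local field has a quasi-character
twist whose Rankin–Selberg `L`-polynomial (`HasRSLFactor` at `(2, 1)` against `glOneRep ξ`) is not
`1`.  It is spelled out (rather than named) so that this file is a pure proof; it is vendored
verbatim as the Literature named fact `Bump1997_gl2_exists_twist_rsLFactor_ne_one`. -/

variable (hB : ∀ (E : Type) [Field E] [ValuativeRel E] [TopologicalSpace E] [IsNonarchimedeanLocalField E]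
    (π : SmoothIrrep (GL (Fin 2) E)) (ψ : AddChar E Circle), ψ.IsContinuousNontrivial →
    IsGeneric π.ρ ψ → ¬ π.ρ.IsSupercuspidal →
    ∃ ξ : QuasiChar E, ∀ [MeasurableSpace (GL (Fin 1) E ⧸ upperUnitriangular (Fin 1) E)]
      [BorelSpace (GL (Fin 1) E ⧸ upperUnitriangular (Fin 1) E)]
      (ν : Measure (GL (Fin 1) E ⧸ upperUnitriangular (Fin 1) E))
      [SMulInvariantMeasure (GL (Fin 1) E) (GL (Fin 1) E ⧸ upperUnitriangular (Fin 1) E) ν]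
      [IsFiniteMeasureOnCompacts ν] [ν.IsOpenPosMeasure] (P : ℂ[X]),
      HasRSLFactor Nat.one_lt_two π.ρ (glOneRep (ξ : Eˣ →* ℂˣ)) ψ ν P → P ≠ 1)

include hB

/-- **The pair Euler factors of `rec₂[π]` against quasi-character classes are non-trivial
somewhere, for generic non-supercuspidal `π`** (hypothesis `hB` read through clause (iii-L) at
`(2, 1)` with `π' = ξ ∘ det` on `ℂ`, whose underlying representation is `glOneRep ξ` by `rfl`).
[cite: Bump1997, §4.7 Prop. 4.7.5] [cite: JacquetLanglands1970, Props. 3.5–3.6] -/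
theorem exists_pairEulerFactor_ne_one_of_not_isSupercuspidal
    (h : IsLocalLanglandsGL F hmul huniq hn hex hns d 𝓔 rec)
    (π : SmoothIrrep (GL (Fin 2) F)) {ψ : AddChar F Circle} (hψ : ψ.IsContinuousNontrivial)
    (hg : IsGeneric π.ρ ψ) (hnsc : ¬ π.ρ.IsSupercuspidal) :
    ∃ χ₀ : QuasiChar F, (((rec 2 (IrrClass.mk π)).out.1).tprod
      ((rec 1 (IrrClass.mk (SmoothIrrep.ofQuasiChar χ₀))).out.1)).eulerFactor hn hex ≠ 1 := by
  obtain ⟨ξ, hξ⟩ := hB F π ψ hψ hg hnsc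
  refine ⟨ξ, ?_⟩
  letI : MeasurableSpace F := borel F
  haveI : BorelSpace F := ⟨rfl⟩
  letI : MeasurableSpace (GL (Fin 1) F ⧸ upperUnitriangular (Fin 1) F) := borel _
  haveI : BorelSpace (GL (Fin 1) F ⧸ upperUnitriangular (Fin 1) F) := ⟨rfl⟩
  obtain ⟨_, _, ν, hinv, hfin, hpos, -⟩ := exists_haar_measure_quotient_fin_one (F := F)
  haveI := hinv
  haveI := hfin
  haveI := hpos
  set π' : SmoothIrrep (GL (Fin 1) F) := SmoothIrrep.ofQuasiChar ξ with hπ'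
  haveI : Nontrivial π'.V := Module.nontrivial_of_finrank_eq_succ π'.finrank_eq_one_glOne
  have hg' : IsGeneric π'.ρ ψ⁻¹ := isGeneric_of_fin_one _ _
  have hRS := (h.lFactor_pairs Nat.one_pos Nat.one_lt_two π π' ψ hψ hg hg' ν _).2 rfl
  exact hξ ν _ hRS

/-- **The twist data of `rec₂[π]` are non-trivial somewhere, for generic non-supercuspidal `π`**
(conditional on the Bump 1997 §4.7 fact). [cite: Bump1997, §4.7 Prop. 4.7.5] -/
theorem exists_twistEulerFactor_ne_one_of_not_isSupercuspidal
    (h : IsLocalLanglandsGL F hmul huniq hn hex hns d 𝓔 rec)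
    (π : SmoothIrrep (GL (Fin 2) F)) {ψ : AddChar F Circle} (hψ : ψ.IsContinuousNontrivial)
    (hg : IsGeneric π.ρ ψ) (hnsc : ¬ π.ρ.IsSupercuspidal) :
    ∃ χ₀ : QuasiChar F, (((rec 2 (IrrClass.mk π)).out.1).tprod
      (WeilDeligneRep.ofQuasiCharOn (Fin 1 → ℂ) hns d χ₀)).eulerFactor hn hex ≠ 1 := by
  obtain ⟨χ₀, h0⟩ := exists_pairEulerFactor_ne_one_of_not_isSupercuspidal hB h π hψ hg hnsc
  exact ⟨χ₀, by rwa [twistEulerFactor_eq_pair h π χ₀]⟩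

/-- **Rank-2 generic rigidity for two correspondences with the same normalising data**
(conditional on the Bump fact): `rec₂[π] = rec'₂[π]` for generic non-supercuspidal `π`.
[cite: Henniarts1993, Thm 1.1] [cite: Bump1997, §4.7] -/
theorem rec_two_eq_of_isGeneric_of_not_isSupercuspidal
    (h : IsLocalLanglandsGL F hmul huniq hn hex hns d 𝓔 rec)
    (h' : IsLocalLanglandsGL F hmul huniq hn hex hns d 𝓔 rec')
    (π : SmoothIrrep (GL (Fin 2) F)) {ψ : AddChar F Circle} (hψ : ψ.IsContinuousNontrivial)
    (hg : IsGeneric π.ρ ψ) (hnsc : ¬ π.ρ.IsSupercuspidal) :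
    rec 2 (IrrClass.mk π) = rec' 2 (IrrClass.mk π) := by
  obtain ⟨χ₀, h0⟩ := exists_twistEulerFactor_ne_one_of_not_isSupercuspidal hB h π hψ hg hnsc
  have hT := isEquivalent_of_twistData_eq hn hex hns d (by simp) (by simp)
    (rec 2 (IrrClass.mk π)).out.1 (rec' 2 (IrrClass.mk π)).out.1
    (rec 2 (IrrClass.mk π)).out.2 (rec' 2 (IrrClass.mk π)).out.2 χ₀ h0
    (twistEulerFactor_eq_of_isLocalLanglandsGL h h' π hψ hg)
  exact Quotient.out_equiv_out.1 hT

end Final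

section ReciprocityDataLevel

variable {K : Type} [Field K] [NumberField K]

/-- Transport of the six-clause property along an equality of local Artin data. [folklore] -/
theorem isLocalLanglandsGL_of_artin_eq' {F : Type} [Field F] [ValuativeRel F] [TopologicalSpace F]
    [IsNonarchimedeanLocalField F]
    {hmul : IsFrobPow.mul (F := F)} {huniq : IsFrobPow.unique (F := F)}
    {hn : absInertia_normal F} {hex : exists_isFrobPow (F := F)}
    {hns : WeilGroup.exists_subgroup_le_inertia_isOpen_of_continuous (F := F)}
    {d d' : LocalArtinData F} (hd : d = d') {𝓔 : LocalEpsilonSystem F}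
    {rec : ∀ n : ℕ, IrrClass (GL (Fin n) F) → Quotient (frobSemisimpleWDSetoid F n)}
    (h : IsLocalLanglandsGL F hmul huniq hn hex hns d' 𝓔 rec) :
    IsLocalLanglandsGL F hmul huniq hn hex hns d 𝓔 rec := by
  subst hd
  exact h

/-- The six-clause property of `𝓡'.llc v` re-read against the normalising pair of `𝓡.llc v`
(pins + ε-transport, stubs S1/S2). [folklore] -/
theorem isLocalLanglandsGL_transport' (𝓡 𝓡' : ReciprocityData K) (v : HeightOneSpectrum (𝓞 K)) :
    IsLocalLanglandsGL (v.adicCompletion K) (𝓡.llc v).hmul (𝓡.llc v).huniq (𝓡.llc v).hn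
      (𝓡.llc v).hex (𝓡.llc v).hns (𝓡.llc v).artin (𝓡.llc v).eps (𝓡'.llc v).recGL :=
  stub_isLocalLanglandsGL_of_eps_artin_eq (stub_llc_eps_artin_eq 𝓡 𝓡' v)
    (isLocalLanglandsGL_of_artin_eq' (localArtinData_eq_of_artin_eq (𝓡.artin_eq 𝓡' v))
      (𝓡'.llc v).isLocalLanglands)

variable
  (hB : ∀ (E : Type) [Field E] [ValuativeRel E] [TopologicalSpace E] [IsNonarchimedeanLocalField E]
    (π : SmoothIrrep (GL (Fin 2) E)) (ψ : AddChar E Circle), ψ.IsContinuousNontrivial →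
    IsGeneric π.ρ ψ → ¬ π.ρ.IsSupercuspidal →
    ∃ ξ : QuasiChar E, ∀ [MeasurableSpace (GL (Fin 1) E ⧸ upperUnitriangular (Fin 1) E)]
      [BorelSpace (GL (Fin 1) E ⧸ upperUnitriangular (Fin 1) E)]
      (ν : Measure (GL (Fin 1) E ⧸ upperUnitriangular (Fin 1) E))
      [SMulInvariantMeasure (GL (Fin 1) E) (GL (Fin 1) E ⧸ upperUnitriangular (Fin 1) E) ν]
      [IsFiniteMeasureOnCompacts ν] [ν.IsOpenPosMeasure] (P : ℂ[X]),
      HasRSLFactor Nat.one_lt_two π.ρ (glOneRep (ξ : Eˣ →* ℂˣ)) ψ ν P → P ≠ 1)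

include hB

/-- **S5a — rank 2 of the registered stub S5, conditional on the Bump 1997 §4.7 fact**: two PINNED
reciprocity data of a number field have the same `rec₂` on every generic non-supercuspidal class of
every completion. [cite: Henniarts1993, Thm 1.1] [cite: Bump1997, §4.7] -/
theorem recGL_two_eq_of_isGeneric_of_not_isSupercuspidal
    (𝓡 𝓡' : ReciprocityData K) (v : HeightOneSpectrum (𝓞 K))
    (πv : SmoothIrrep (GL (Fin 2) (v.adicCompletion K)))
    (ψ : AddChar (v.adicCompletion K) Circle) (hψ : ψ.IsContinuousNontrivial)
    (hg : IsGeneric πv.ρ ψ) (hnsc : ¬ (IrrClass.mk πv).IsSupercuspidal) :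
    (𝓡.llc v).recGL 2 (IrrClass.mk πv) = (𝓡'.llc v).recGL 2 (IrrClass.mk πv) := by
  rw [IrrClass.isSupercuspidal_mk] at hnsc
  exact rec_two_eq_of_isGeneric_of_not_isSupercuspidal hB (𝓡.llc v).isLocalLanglands
    (isLocalLanglandsGL_transport' 𝓡 𝓡' v) πv hψ hg hnsc

end ReciprocityDataLevel

section RankTwoTransport

variable {K : Type} [Field K] [NumberField K]
  (hB : ∀ (E : Type) [Field E] [ValuativeRel E] [TopologicalSpace E] [IsNonarchimedeanLocalField E]
    (π : SmoothIrrep (GL (Fin 2) E)) (ψ : AddChar E Circle), ψ.IsContinuousNontrivial →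
    IsGeneric π.ρ ψ → ¬ π.ρ.IsSupercuspidal →
    ∃ ξ : QuasiChar E, ∀ [MeasurableSpace (GL (Fin 1) E ⧸ upperUnitriangular (Fin 1) E)]
      [BorelSpace (GL (Fin 1) E ⧸ upperUnitriangular (Fin 1) E)]
      (ν : Measure (GL (Fin 1) E ⧸ upperUnitriangular (Fin 1) E))
      [SMulInvariantMeasure (GL (Fin 1) E) (GL (Fin 1) E ⧸ upperUnitriangular (Fin 1) E) ν]
      [IsFiniteMeasureOnCompacts ν] [ν.IsOpenPosMeasure] (P : ℂ[X]),
      HasRSLFactor Nat.one_lt_two π.ρ (glOneRep (ξ : Eˣ →* ℂˣ)) ψ ν P → P ≠ 1)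

include hB

/-- **Rank-2 rigidity on ALL generic classes** (conditional on Henniart's uniqueness on
supercuspidals at the place `v` — the named fact `localLanglands_gl` for the normalising pair of
`𝓡.llc v` — and on the Bump 1997 §4.7 fact). [cite: Henniarts1993, Thm 1.1] [cite: Bump1997, §4.7] -/
theorem recGL_two_eq_of_isGeneric
    (𝓡 𝓡' : ReciprocityData K) (v : HeightOneSpectrum (𝓞 K))
    (hS09 : localLanglands_gl (v.adicCompletion K) (𝓡.llc v).hmul (𝓡.llc v).huniq (𝓡.llc v).hn
      (𝓡.llc v).hex (𝓡.llc v).hns (𝓡.llc v).artin (𝓡.llc v).eps (𝓡.llc v).eps_artin)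
    (πv : SmoothIrrep (GL (Fin 2) (v.adicCompletion K)))
    (ψ : AddChar (v.adicCompletion K) Circle) (hψ : ψ.IsContinuousNontrivial)
    (hg : IsGeneric πv.ρ ψ) :
    (𝓡.llc v).recGL 2 (IrrClass.mk πv) = (𝓡'.llc v).recGL 2 (IrrClass.mk πv) := by
  by_cases hsc : (IrrClass.mk πv).IsSupercuspidal
  · exact IsLocalLanglandsGL.unique_of_isSupercuspidal (v.adicCompletion K) _ _ _ _ _
      (𝓡.llc v).eps_artin hS09 (𝓡.llc v).isLocalLanglands (isLocalLanglandsGL_transport' 𝓡 𝓡' v)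
      _ hsc
  · exact recGL_two_eq_of_isGeneric_of_not_isSupercuspidal hB 𝓡 𝓡' v πv ψ hψ hg hsc

/-- **The summit's `∀ 𝓡` is free in rank 2** (modulo Henniart 1993 at every place and Bump 1997
§4.7): the global correspondence `(A) ∧ (B)` for `GL₂` over `K` transports from one pinned
reciprocity datum to any other (`globalLanglands_transport` + local components are generic).
[cite: Henniarts1993, Thm 1.1] [cite: Bump1997, §4.7] -/
theorem globalLanglands_two_transport
    (𝓡 𝓡' : ReciprocityData K)
    (hS09 : ∀ v : HeightOneSpectrum (𝓞 K), localLanglands_gl (v.adicCompletion K) (𝓡.llc v).hmul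
      (𝓡.llc v).huniq (𝓡.llc v).hn (𝓡.llc v).hex (𝓡.llc v).hns (𝓡.llc v).artin (𝓡.llc v).eps
      (𝓡.llc v).eps_artin)
    {hcpt : isCompact_glFiniteIntegralLevel 2 K} (hG : GlobalLanglandsCorrespondenceGLn 2 K 𝓡 hcpt) :
    GlobalLanglandsCorrespondenceGLn 2 K 𝓡' hcpt := by
  refine globalLanglands_transport 𝓡 𝓡' (fun π v πv hπv => ?_) hG
  obtain ⟨ψ, hψ, hg⟩ := π.exists_isGeneric_of_hasLocalComponentAt v πv.ρ πv.isSmooth hπv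
  exact recGL_two_eq_of_isGeneric hB 𝓡 𝓡' v (hS09 v) πv ψ hψ hg

end RankTwoTransport

end Summit.Langlands.Langlands.Theorems.ReciprocityRigidity

end
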